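import Summits.ResolutionOfSingularities.ResolutionOfSingularities.Theorems.EquisingularLiftCampaignW45bULT
import Summits.ResolutionOfSingularities.ResolutionOfSingularities.Theorems.EquisingularLiftEquisingularLiftNatFirstTouch
import Summits.ResolutionOfSingularities.ResolutionOfSingularities.Theorems.EquisingularLiftEquisingularLiftProjectiveAmbientFibre
import HarnessLib

/-!
# [OURS · L1 W4.5(b) · EL♮] `EquisingularLiftNat p → ULTWeak p` — the V-FREE first-touch implication, packaged against
# the typed target `EquisingularLift.ULTWeak` (crux `EquisingularLiftNat` = stmt-ResolutionOfSingularities-20038)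

HONEST FRAMING. OURS (cell res-hironaka, crux chain w45b, slot W4.5(b)); NOT a statement of any manuscript; AI-written,
weaker than expert review. Helper `--supports stmt-ResolutionOfSingularities-20038 --as helper`; object (2) of
res-L1-type-o1's INPUT 2026-08-27T05:10:31Z, assigned by custody (res-plan-2 D→L MAP v1.10a) to res-D-pv-003 AS
w45b-helper-B. Plan of record: L/w45b/CRUX-PLAN.md v3 §1.3/§1.6 «ULT», L/w45b/EL-NATURAL/ULT-L0COMP-WORDS.md §ULT.

WHAT IS PROVED. `EquisingularLift.ultWeak_of_equisingularLiftNat : EquisingularLiftNat p → EquisingularLift.ULTWeak p`: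
the item EL♮ implies the typed necessary condition ULTWeak (ULT without horizontality) at EVERY point `h` of `H` whose
local ring is not regular (the typed binder (B) also carries «`h` not closed», which is not used). The geometric content —
a blow-up step whose centre misses the point over `x` keeps a point over `x` in the strict transform with NON-regular stalk
of the reduced strict transform, so regularity at the end forces some centre to pass through a point over `x` — is
res-L1-w45b-lead-1's `Cruxes.EquisingularLiftNat.Sections.exists_touching_centre_of_equisingularLiftNat`
(`Theorems/EquisingularLiftEquisingularLiftNatFirstTouch.lean`), consumed BY NAME. This file adds the BRIDGE from the
typed binder on the `H` side to that theorem's hypothesis on the ambient side, and the repackaging: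

* `isRegularLocalRing_stalk_iff_of_range_eq` — two closed immersions from REDUCED schemes with the same range are
  isomorphic over the target (equal kernels = the vanishing ideal sheaf of the common range; `IsClosedImmersion.isIso_lift`),
  so the stalks at corresponding points are isomorphic and one is regular iff the other is (pattern of
  `StrataSplit.stub_reducedStalkOverIso`, whose lemma of this name is private).
* `exists_vanishingIdeal_witness_of_not_isRegularLocalRing` — BRIDGE: for a closed immersion `f : A ⟶ Y` from a reduced
  scheme and a point `a` with non-regular stalk, the reduced induced closed subscheme `V(closure (range f))` has a point
  `w` over `f a` with non-regular stalk.
* `isClosedImmersion_projMap` — `Proj.map φ : ℙⁿ_k ⟶ ℙⁿ_O` is a closed immersion for `φ = MvPolynomial.map π`, `π : O → k`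
  surjective (base change of the closed immersion `Spec k ⟶ Spec O` along the cartesian square
  `StrataSplit.ProjectiveAmbientFibre.isPullback_projMap`).
* `ultWeak_of_equisingularLiftNat` — THE OBJECT: `obtain` over `exists_touching_centre_of_equisingularLiftNat` at
  `x := (ι ≫ Proj.map φ) h`, with the bridge supplying its non-regularity witness; the E1 conclusion «`⊆ Y₀`» of that
  theorem gives the typed «`⊆ closure Y₀`» by `subset_closure`; conjuncts reordered.
* `not_equisingularLiftNat_of_not_ultWeakAt` — pure logic (the disprover's V-free exit): ONE instance `(k, n, H, ι, h)`
  satisfying binder (B) with `¬ ULTWeakAt p k n H ι h` refutes `EquisingularLiftNat p` outright (no lemma V needed).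

Nothing here uses a `Literature.…` FACT about the manuscript; no `sorry`; standard axioms.

References: U. Görtz, T. Wedhorn, *Algebraic Geometry I* (2nd ed. 2020) Prop. 13.91 (3) [GortzWedhorn2020]; Stacks Project
Tag 01J3 (reduced induced closed subscheme); Q. Liu, *Algebraic Geometry and Arithmetic Curves* (2002) Prop. 3.1.9 (base
change of `Proj`) [Liu2002] — context for the tree lemmas used; OURS planning texts (index only): L/w45b/CRUX-PLAN.md v3,
L/w45b/EL-NATURAL/ULT-L0COMP-WORDS.md.
-/

set_option linter.dupNamespace false -- mandated namespace `Summit.<Summit>.<Problem>` of this single-conjunct summit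

open CategoryTheory AlgebraicGeometry TopologicalSpace
open AlgebraicGeometry.Scheme.IdealSheafData Literature.AlgebraicGeometry.Resolution

universe u

namespace Summit.ResolutionOfSingularities.ResolutionOfSingularities.Theorems.EquisingularLift

/-! ## Stalks of closed immersions from reduced schemes with equal range -/

/-- Regularity of (local) rings is invariant under isomorphisms of commutative rings. [folklore] -/
private theorem isRegularLocalRing_iff_of_iso {A B : CommRingCat.{u}} (e : A ≅ B) :
    IsRegularLocalRing A ↔ IsRegularLocalRing B :=
  ⟨fun _ => IsRegularLocalRing.of_ringEquiv e.commRingCatIsoToRingEquiv,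
    fun _ => IsRegularLocalRing.of_ringEquiv e.commRingCatIsoToRingEquiv.symm⟩

/-- The kernel of a morphism from a reduced scheme is the vanishing ideal sheaf of the closure of its range.
[folklore; Stacks 01J3] -/
private theorem ker_eq_vanishingIdeal_closure_range {A Y : Scheme.{u}} (g : A ⟶ Y) [IsReduced A] :
    g.ker = vanishingIdeal (.closure (Set.range g)) := by
  rw [← map_bot, ← Scheme.nilradical_eq_bot, ← vanishingIdeal_top, map_vanishingIdeal,
    Closeds.coe_top, Set.image_univ]

/-- Two closed immersions from REDUCED schemes with the same range are isomorphic over the target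
(`IsClosedImmersion.isIso_lift`: both kernels are the vanishing ideal sheaf of the common range), so their stalks at
corresponding points are isomorphic; in particular one is a regular local ring iff the other is.
[folklore; GW I Prop. 13.91 (3), Stacks 01J3] -/
theorem isRegularLocalRing_stalk_iff_of_range_eq {A₁ A₂ Y : Scheme.{u}} (g₁ : A₁ ⟶ Y) (g₂ : A₂ ⟶ Y)
    [IsClosedImmersion g₁] [IsClosedImmersion g₂] [IsReduced A₁] [IsReduced A₂]
    (h : Set.range g₁ = Set.range g₂) {a₁ : A₁} {a₂ : A₂} (ha : g₂ a₂ = g₁ a₁) :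
    IsRegularLocalRing (A₂.presheaf.stalk a₂) ↔ IsRegularLocalRing (A₁.presheaf.stalk a₁) := by
  have hker : g₁.ker = g₂.ker := by
    rw [ker_eq_vanishingIdeal_closure_range, ker_eq_vanishingIdeal_closure_range, h]
  haveI := IsClosedImmersion.isIso_lift g₁ g₂ hker
  have hφ : IsClosedImmersion.lift g₁ g₂ hker.le a₂ = a₁ := by
    apply g₁.isClosedEmbedding.injective
    rw [← Scheme.Hom.comp_apply, IsClosedImmersion.lift_fac, ha]
  rw [← isRegularLocalRing_iff_of_iso (asIso ((IsClosedImmersion.lift g₁ g₂ hker.le).stalkMap a₂)), hφ]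

/-! ## BRIDGE: from a non-regular point of `A` to a non-regular point of `V(closure (range f))` -/

/-- **BRIDGE.** For a closed immersion `f : A ⟶ Y` from a REDUCED scheme `A` and a point `a ∈ A` whose local ring is not
regular, the reduced induced closed subscheme `V(closure (range f))` of `Y` has a point `w` lying over `f a` whose local
ring is not regular (`A ≅ V(closure (range f))` over `Y`). This is the hypothesis shape of
`Cruxes.EquisingularLiftNat.Sections.exists_touching_centre_of_natChain`. [folklore; Stacks 01J3] -/
theorem exists_vanishingIdeal_witness_of_not_isRegularLocalRing {A Y : Scheme.{u}} (f : A ⟶ Y)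
    [IsClosedImmersion f] [IsReduced A] {a : A} (ha : ¬ IsRegularLocalRing (A.presheaf.stalk a)) :
    ∃ w : ↥(vanishingIdeal (⟨closure (Set.range f), isClosed_closure⟩ : Closeds Y)).subscheme,
      (vanishingIdeal (⟨closure (Set.range f), isClosed_closure⟩ : Closeds Y)).subschemeι w = f a ∧
      ¬ IsRegularLocalRing
        ((vanishingIdeal (⟨closure (Set.range f), isClosed_closure⟩ : Closeds Y)).subscheme.presheaf.stalk w) := by
  set Z : Closeds Y := ⟨closure (Set.range f), isClosed_closure⟩ with hZ
  have hZrange : (Z : Set Y) = Set.range f := f.isClosedEmbedding.isClosed_range.closure_eq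
  haveI := ComponentGluing.isReduced_subscheme_vanishingIdeal Z
  obtain ⟨w, hw⟩ : f a ∈ Set.range (vanishingIdeal Z).subschemeι := by
    rw [ComponentGluing.range_subschemeι_vanishingIdeal, hZrange]; exact ⟨a, rfl⟩
  refine ⟨w, hw, fun hreg => ha ?_⟩
  exact (isRegularLocalRing_stalk_iff_of_range_eq f (vanishingIdeal Z).subschemeι
    ((ComponentGluing.range_subschemeι_vanishingIdeal Z).trans hZrange).symm hw).mp hreg

/-! ## `Proj.map φ : ℙⁿ_k ⟶ ℙⁿ_O` is a closed immersion -/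

/-- For a surjection `π : O → k` and a graded `φ` inducing `MvPolynomial.map π`, the comparison map
`Proj.map φ : ℙ(ι)_k ⟶ ℙ(ι)_O` is a closed immersion: it is the base change of the closed immersion `Spec k ⟶ Spec O`
along the cartesian square `StrataSplit.ProjectiveAmbientFibre.isPullback_projMap`. [folklore; Liu 2002 Prop. 3.1.9] -/
theorem isClosedImmersion_projMap {O k : Type} [CommRing O] [CommRing k] (π : O →+* k)
    (hπ : Function.Surjective π) {ι : Type} :
    letI := MvPolynomial.gradedAlgebra (σ := ι) (R := O)
    letI := MvPolynomial.gradedAlgebra (σ := ι) (R := k)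
    ∀ (φ : MvPolynomial.homogeneousSubmodule ι O →+*ᵍ MvPolynomial.homogeneousSubmodule ι k)
      (_ : ∀ s, φ s = MvPolynomial.map π s)
      (hφ' : HomogeneousIdeal.irrelevant (MvPolynomial.homogeneousSubmodule ι k) ≤
        (HomogeneousIdeal.irrelevant (MvPolynomial.homogeneousSubmodule ι O)).map φ),
      IsClosedImmersion (Proj.map φ hφ') := by
  intro φ hφ hφ'
  have hP := Cruxes.EquisingularLift.StrataSplit.ProjectiveAmbientFibre.isPullback_projMap π φ hφ hπ hφ'
  haveI : IsClosedImmersion (Spec.map (CommRingCat.ofHom π)) :=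
    IsClosedImmersion.spec_of_surjective _ hπ
  exact MorphismProperty.IsStableUnderBaseChange.of_isPullback hP.flip inferInstance

/-! ## THE OBJECT: `EquisingularLiftNat p → ULTWeak p` -/

/-- **[OURS · L1 W4.5(b)] `EquisingularLiftNat p → ULTWeak p` (the V-FREE first-touch implication).** If the item EL♮ holds
at the prime `p`, then for every instance `(k, n, H, ι)` of the item and EVERY point `h` of `H` whose local ring is not
regular (binder (B); «`h` not closed» is not used), for the `O, π` the item provides and every `φ, Y` as in the item, there
are a stage `(P′, σ, S′)` in the inductive closure of `(ℙⁿ_O, 𝟙, Y)` under E1-steps whose centres AVOID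
`x := (ι ≫ Proj.map φ) h`, and an ideal sheaf `C` on `P′` with `V(C)` regular, a point `x′ ∈ supp C` over `x`,
`supp C ∩ (σ ≫ q)⁻¹{s₀} ⊆ closure S′` (E1) and `σ(supp C)` off the generic points of `Y`. Proof: `H` is integral hence
reduced and `ι ≫ Proj.map φ` is a closed immersion (`isClosedImmersion_projMap`), so the BRIDGE turns the non-regular
stalk `𝒪_{H,h}` into a non-regular stalk of `V(closure Y)` over `x`; then res-L1-w45b-lead-1's
`exists_touching_centre_of_equisingularLiftNat` (first touch: `nonregular_point_persists` along the chain, regularity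
of `V(closure S′)` at the end) gives the touching centre, whose E1 clause «`⊆ Y₀`» implies «`⊆ closure Y₀`».
Replaces the role of NOTHING in the manuscript; NOT a statement of the manuscript. [folklore] -/
theorem ultWeak_of_equisingularLiftNat {p : ℕ}
    (hE : Summit.ResolutionOfSingularities.ResolutionOfSingularities.Theorems.EquisingularLiftNat p) :
    ULTWeak p := by
  intro hp k _ _ _ n H ι hι hH hloc h hreg _
  obtain ⟨O, i1, i2, i3, i4, π, hπ, h'⟩ :=
    Cruxes.EquisingularLiftNat.Sections.exists_touching_centre_of_equisingularLiftNat hE hp k n H ι hι hH hloc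
  refine ⟨O, i1, i2, i3, i4, π, hπ, ?_⟩
  intro φ hφ' hφ Y hY
  haveI := hH
  -- `ι ≫ Proj.map φ` is a closed immersion from the reduced scheme `H` (instances passed explicitly: the codomain of `ι`
  -- is `(projectiveSpace n k).left`, definitionally `Proj k[x₀,…,xₙ]`)
  have hci := @IsClosedImmersion.comp _ _ _ ι _ hι (isClosedImmersion_projMap π hπ φ hφ hφ')
  have hx := @exists_vanishingIdeal_witness_of_not_isRegularLocalRing _ _ _ hci inferInstance _ hreg
  subst hY
  obtain ⟨X₀, σ₀, Y₀, C₀, hav, hC, hpt, hgen, hE1⟩ := h' φ hφ' hφ _ rfl _ ⟨h, rfl⟩ hx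
  exact ⟨X₀, σ₀, Y₀, hav, C₀, hC, hpt, hE1.trans subset_closure, hgen⟩

/-- Pure logic (the disprover's V-FREE exit): ONE instance `(k, n, H, ι, h)` satisfying binder (B) with `¬ ULTWeakAt`
refutes the item `EquisingularLiftNat p` outright, via `ultWeak_of_equisingularLiftNat` (no lemma V needed; compare
`not_equisingularLiftNat_of_not_ult`, which needs the implication to `ULT`). [folklore] -/
theorem not_equisingularLiftNat_of_not_ultWeakAt {p : ℕ} (hp : p.Prime) {k : Type} [Field k] [CharP k p]
    [IsAlgClosed k] {n : ℕ} {H : AlgebraicGeometry.Scheme.{0}}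
    {ι : H ⟶ (Literature.AlgebraicGeometry.Motives.projectiveSpace n k).left}
    (hι : AlgebraicGeometry.IsClosedImmersion ι) (hH : AlgebraicGeometry.IsIntegral H)
    (hloc : ∀ y : (Literature.AlgebraicGeometry.Motives.projectiveSpace n k).left,
      ∃ U : (Literature.AlgebraicGeometry.Motives.projectiveSpace n k).left.affineOpens,
        y ∈ (U : (Literature.AlgebraicGeometry.Motives.projectiveSpace n k).left.Opens) ∧ (ι.ker.ideal U).IsPrincipal)
    {h : H} (h1 : ¬ IsRegularLocalRing (H.presheaf.stalk h)) (h2 : ¬ IsClosed ({h} : Set H))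
    (hno : ¬ ULTWeakAt p k n H ι h) :
    ¬ Summit.ResolutionOfSingularities.ResolutionOfSingularities.Theorems.EquisingularLiftNat p :=
  fun hE => hno (ultWeak_of_equisingularLiftNat hE hp k n H ι hι hH hloc h h1 h2)

end Summit.ResolutionOfSingularities.ResolutionOfSingularities.Theorems.EquisingularLift
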